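import Literature.AlgebraicGeometry.Frobenioids.Cor411iiiAtSetting
import Literature.AlgebraicGeometry.Frobenioids.Thm42AssemblyOfPreSteps
import HarnessLib

/-!
# Frobenioids I, Corollary 4.11 (iii)/(iv), perfect-type closers from Theorem 3.4 (ii) alone and over
# bases of FSMFF-type in the author's revised sense

Mochizuki, *The geometry of Frobenioids I: the general theory*, Kyushu J. Math. **62** (2008)
293–400, kurims text: Cor. 4.11 (iii), (iv) p. 92, proof p. 94 [cite: MochizukiFrdI2008, Cor. 4.11 (iii) p.92];
Theorem 3.4 (ii)(iii) p. 62; condition (b) of "FSMFF-type" as revised by the author (*Comments*, January 2024,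
item (28)) [cite: MochizukiFrdIComments2024, (28) p.3].

PROOF-ONLY file (seat abc-iut-L1-t14, rows `FrdI:Cor4.11(iii)`, `FrdI:Cor4.11(iv)`; continuation of
`Cor411iiiAtSetting.lean`). Everything BY NAME, no re-proving:

* `FrdI.T42.cor411iii/iv_of_perfectType_of_preservesPreSteps` — the typed (iii)/(iv) for Frobenioids of
  PERFECT and isotropic, non-group-like type from "`Ψ`, `Ψ⁻¹` preserve pre-steps" (Thm. 3.4 (ii)) alone, no
  hypothesis on the base categories: the setting of the proof of Thm. 4.2 by seat abc-iut-L1-t11's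
  `PreFrobenioidData.setting_of_preservesPreSteps`, then `FrdI.T42.cor411iii/iv_inst_of_setting`;
* `FrdI.T42.cor411iii/iv_of_perfectType_of_isOfFSMFFType2024` — the same over bases of FSMFF-type in the
  author's revised sense (`setting_of_isOfFSMFFType2024`, abc-iut-L1-t11): NO Thm. 3.4 / Thm. 4.2 / Thm. 4.9
  hypothesis left.

Hypotheses are print's: "birationally Frobenius-normalized type" (Def. 4.5 (iii)(a)); a support predicate with
the support axiom of Def. 2.4 (i)(d); "every universally Div-Frobenius-trivial object is rational" at THE
birationalization (Def. 4.5 (ii)(iii)); isotropic / not group-like = the reductions of p. 92 ("we may assume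
without loss of generality …", Rmk. 4.5.1) taken as hypotheses. The parameters `R_i : RSParams` are
arbitrary. No new definitions; nothing of the paper is restated or strengthened; nothing here is specific to
the abc programme and no side is taken on [IUTchIII] Cor. 3.12.
-/

namespace Literature.AlgebraicGeometry.Frobenioids

open CategoryTheory Opposite

universe w v v' u u'

namespace FrdI.T42

open PreFrobenioid

variable {D₁ : Type u} [Category.{v} D₁] {Φ₁ : D₁ᵒᵖ ⥤ CommMonCat.{w}} {C₁ : Type u'} [Category.{v'} C₁]
  {D₂ : Type u} [Category.{v} D₂] {Φ₂ : D₂ᵒᵖ ⥤ CommMonCat.{w}} {C₂ : Type u'} [Category.{v'} C₂]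
  {F₁ : C₁ ⥤ ElemFrobenioid Φ₁} {F₂ : C₂ ⥤ ElemFrobenioid Φ₂}

/-- The hypotheses `Thm42Setting` of the typed Thm. 4.2 from `Cor411Setting` (standard type) and the two
reductions of the proof of Cor. 4.11 taken as hypotheses: "we may assume without loss of generality that
`C₁, C₂` are of isotropic type … not of group-like type" (p. 92). [cite: MochizukiFrdI2008, Cor. 4.11 p.92] -/
theorem thm42Setting_of_cor411Setting {Ψ : C₁ ≌ C₂}
    (histr₁ : IsOfIsotropicType F₁) (histr₂ : IsOfIsotropicType F₂)
    (hng₁ : ¬ (PreFrobenioidData.ofFunctor Φ₁ F₁).IsOfGroupLikeType)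
    (hng₂ : ¬ (PreFrobenioidData.ofFunctor Φ₂ F₂).IsOfGroupLikeType)
    (hs : (PreFrobenioidData.ofFunctor Φ₁ F₁).Cor411Setting (PreFrobenioidData.ofFunctor Φ₂ F₂) Ψ) :
    PreFrobenioidData.Thm42Setting (PreFrobenioidData.ofFunctor Φ₁ F₁) (PreFrobenioidData.ofFunctor Φ₂ F₂) :=
  ⟨hs.standard, ⟨(PreFrobenioidData.ofFunctor_isOfIsotropicType F₁).mpr histr₁,
    (PreFrobenioidData.ofFunctor_isOfIsotropicType F₂).mpr histr₂⟩, ⟨hng₁, hng₂⟩⟩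

/-- **[FrdI] Cor. 4.11 (iii) AS TYPED, perfect-type case, from "`Ψ`, `Ψ⁻¹` preserve pre-steps" — no
hypothesis on the base categories**: for Frobenioids of PERFECT and isotropic, non-group-like type (the
reductions of pp. 78, 89, 92 as hypotheses), `Φ_i` perf-factorial, with the conclusion of Thm. 3.4 (ii) for
`Ψ`, `Ψ⁻¹`; the setting is abc-iut-L1-t11's `setting_of_preservesPreSteps`, the rest is
`cor411iii_inst_of_setting`. [cite: MochizukiFrdI2008, Cor. 4.11 (iii) p.92] -/
theorem cor411iii_of_perfectType_of_preservesPreSteps (hF₁ : IsFrobenioid F₁) (hF₂ : IsFrobenioid F₂)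
    (hperf₁ : IsOfPerfectType F₁) (hperf₂ : IsOfPerfectType F₂)
    (hpf₁ : Objectwise (fun M _ => IsPerfFactorial M) Φ₁) (hpf₂ : Objectwise (fun M _ => IsPerfFactorial M) Φ₂)
    (histr₁ : IsOfIsotropicType F₁) (histr₂ : IsOfIsotropicType F₂) (Ψ : C₁ ≌ C₂)
    (hng₁ : ¬ (PreFrobenioidData.ofFunctor Φ₁ F₁).IsOfGroupLikeType)
    (hng₂ : ¬ (PreFrobenioidData.ofFunctor Φ₂ F₂).IsOfGroupLikeType)
    (hΨ : ∀ ⦃X Y : C₁⦄ (φ : X ⟶ Y), IsPreStep F₁ φ → IsPreStep F₂ (Ψ.functor.map φ))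
    (hΨ' : ∀ ⦃X Y : C₂⦄ (φ : X ⟶ Y), IsPreStep F₂ φ → IsPreStep F₁ (Ψ.inverse.map φ))
    (hbfn₁ : ∀ A : C₁, IsBiratFrobeniusNormalized F₁ hF₁ (hasBiratSquares_of_isFrobenioid hF₁) A)
    (hbfn₂ : ∀ A : C₂, IsBiratFrobeniusNormalized F₂ hF₂ (hasBiratSquares_of_isFrobenioid hF₂) A)
    (Supp : ∀ {X : D₁}, (PreFrobenioidData.ofFunctor Φ₁ F₁).Mon X →
      Primes ((PreFrobenioidData.ofFunctor Φ₁ F₁).Mon X) → Prop)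
    (hSupp : ∀ (X : D₁) (a : Φ₁.obj (op X)) (𝔭 : Primes (Φ₁.obj (op X))),
      Supp a 𝔭 ↔ ∃ (a₀ : Φ₁.obj (op X)) (h₀ : IsPrimary a₀),
        Quotient.mk (primarySetoid _) ⟨a₀, h₀⟩ = 𝔭 ∧ Precsim a₀ a)
    (hrat : ∀ ⦃A : C₁⦄, IsUniversallyDivFrobeniusTrivial F₁ A →
      PreFrobenioidData.IsRational (biratData hF₁ (hasBiratSquares_of_isFrobenioid hF₁)) Supp A)
    (R₁ : (PreFrobenioidData.ofFunctor Φ₁ F₁).RSParams) (R₂ : (PreFrobenioidData.ofFunctor Φ₂ F₂).RSParams) :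
    (PreFrobenioidData.ofFunctor Φ₁ F₁).Cor411iii (PreFrobenioidData.ofFunctor Φ₂ F₂) Ψ R₁ R₂ :=
  fun hs => cor411iii_inst_of_setting
    (PreFrobenioidData.setting_of_preservesPreSteps Ψ hF₁ hF₂ hperf₁ hperf₂ hpf₁ hpf₂ hΨ hΨ'
      (thm42Setting_of_cor411Setting histr₁ histr₂ hng₁ hng₂ hs))
    hbfn₁ hbfn₂ Supp hSupp hrat R₁ R₂ hs

/-- **[FrdI] Cor. 4.11 (iv) AS TYPED, perfect-type case, from "`Ψ`, `Ψ⁻¹` preserve pre-steps" — no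
hypothesis on the base categories** (as `cor411iii_of_perfectType_of_preservesPreSteps`, with
`cor411iv_inst_of_setting`). [cite: MochizukiFrdI2008, Cor. 4.11 (iv) p.92] -/
theorem cor411iv_of_perfectType_of_preservesPreSteps (hF₁ : IsFrobenioid F₁) (hF₂ : IsFrobenioid F₂)
    (hperf₁ : IsOfPerfectType F₁) (hperf₂ : IsOfPerfectType F₂)
    (hpf₁ : Objectwise (fun M _ => IsPerfFactorial M) Φ₁) (hpf₂ : Objectwise (fun M _ => IsPerfFactorial M) Φ₂)
    (histr₁ : IsOfIsotropicType F₁) (histr₂ : IsOfIsotropicType F₂) (Ψ : C₁ ≌ C₂)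
    (hng₁ : ¬ (PreFrobenioidData.ofFunctor Φ₁ F₁).IsOfGroupLikeType)
    (hng₂ : ¬ (PreFrobenioidData.ofFunctor Φ₂ F₂).IsOfGroupLikeType)
    (hΨ : ∀ ⦃X Y : C₁⦄ (φ : X ⟶ Y), IsPreStep F₁ φ → IsPreStep F₂ (Ψ.functor.map φ))
    (hΨ' : ∀ ⦃X Y : C₂⦄ (φ : X ⟶ Y), IsPreStep F₂ φ → IsPreStep F₁ (Ψ.inverse.map φ))
    (hbfn₁ : ∀ A : C₁, IsBiratFrobeniusNormalized F₁ hF₁ (hasBiratSquares_of_isFrobenioid hF₁) A)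
    (hbfn₂ : ∀ A : C₂, IsBiratFrobeniusNormalized F₂ hF₂ (hasBiratSquares_of_isFrobenioid hF₂) A)
    (Supp : ∀ {X : D₁}, (PreFrobenioidData.ofFunctor Φ₁ F₁).Mon X →
      Primes ((PreFrobenioidData.ofFunctor Φ₁ F₁).Mon X) → Prop)
    (hSupp : ∀ (X : D₁) (a : Φ₁.obj (op X)) (𝔭 : Primes (Φ₁.obj (op X))),
      Supp a 𝔭 ↔ ∃ (a₀ : Φ₁.obj (op X)) (h₀ : IsPrimary a₀),
        Quotient.mk (primarySetoid _) ⟨a₀, h₀⟩ = 𝔭 ∧ Precsim a₀ a)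
    (hrat : ∀ ⦃A : C₁⦄, IsUniversallyDivFrobeniusTrivial F₁ A →
      PreFrobenioidData.IsRational (biratData hF₁ (hasBiratSquares_of_isFrobenioid hF₁)) Supp A)
    (R₁ : (PreFrobenioidData.ofFunctor Φ₁ F₁).RSParams) (R₂ : (PreFrobenioidData.ofFunctor Φ₂ F₂).RSParams) :
    (PreFrobenioidData.ofFunctor Φ₁ F₁).Cor411iv (PreFrobenioidData.ofFunctor Φ₂ F₂) Ψ R₁ R₂ :=
  fun hs => cor411iv_inst_of_setting
    (PreFrobenioidData.setting_of_preservesPreSteps Ψ hF₁ hF₂ hperf₁ hperf₂ hpf₁ hpf₂ hΨ hΨ'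
      (thm42Setting_of_cor411Setting histr₁ histr₂ hng₁ hng₂ hs))
    hbfn₁ hbfn₂ Supp hSupp hrat R₁ R₂ hs

/-- **[FrdI] Cor. 4.11 (iii) AS TYPED over bases of FSMFF-type (revised), perfect-type case — NO Thm. 3.4 /
Thm. 4.2 / Thm. 4.9 hypothesis left**: pre-steps are preserved there (abc-iut-L1-t11's
`setting_of_isOfFSMFFType2024`, the printed route of Thm. 3.4 (ii) through the revised Prop. 1.14 (iii)).
[cite: MochizukiFrdI2008, Cor. 4.11 (iii) p.92] [cite: MochizukiFrdIComments2024, (28) p.3] -/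
theorem cor411iii_of_perfectType_of_isOfFSMFFType2024 (hF₁ : IsFrobenioid F₁) (hF₂ : IsFrobenioid F₂)
    (hperf₁ : IsOfPerfectType F₁) (hperf₂ : IsOfPerfectType F₂)
    (hpf₁ : Objectwise (fun M _ => IsPerfFactorial M) Φ₁) (hpf₂ : Objectwise (fun M _ => IsPerfFactorial M) Φ₂)
    (hD₁ : IsOfFSMFFType2024 D₁) (hD₂ : IsOfFSMFFType2024 D₂)
    (histr₁ : IsOfIsotropicType F₁) (histr₂ : IsOfIsotropicType F₂) (Ψ : C₁ ≌ C₂)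
    (hng₁ : ¬ (PreFrobenioidData.ofFunctor Φ₁ F₁).IsOfGroupLikeType)
    (hng₂ : ¬ (PreFrobenioidData.ofFunctor Φ₂ F₂).IsOfGroupLikeType)
    (hbfn₁ : ∀ A : C₁, IsBiratFrobeniusNormalized F₁ hF₁ (hasBiratSquares_of_isFrobenioid hF₁) A)
    (hbfn₂ : ∀ A : C₂, IsBiratFrobeniusNormalized F₂ hF₂ (hasBiratSquares_of_isFrobenioid hF₂) A)
    (Supp : ∀ {X : D₁}, (PreFrobenioidData.ofFunctor Φ₁ F₁).Mon X →
      Primes ((PreFrobenioidData.ofFunctor Φ₁ F₁).Mon X) → Prop)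
    (hSupp : ∀ (X : D₁) (a : Φ₁.obj (op X)) (𝔭 : Primes (Φ₁.obj (op X))),
      Supp a 𝔭 ↔ ∃ (a₀ : Φ₁.obj (op X)) (h₀ : IsPrimary a₀),
        Quotient.mk (primarySetoid _) ⟨a₀, h₀⟩ = 𝔭 ∧ Precsim a₀ a)
    (hrat : ∀ ⦃A : C₁⦄, IsUniversallyDivFrobeniusTrivial F₁ A →
      PreFrobenioidData.IsRational (biratData hF₁ (hasBiratSquares_of_isFrobenioid hF₁)) Supp A)
    (R₁ : (PreFrobenioidData.ofFunctor Φ₁ F₁).RSParams) (R₂ : (PreFrobenioidData.ofFunctor Φ₂ F₂).RSParams) :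
    (PreFrobenioidData.ofFunctor Φ₁ F₁).Cor411iii (PreFrobenioidData.ofFunctor Φ₂ F₂) Ψ R₁ R₂ :=
  fun hs => cor411iii_inst_of_setting
    (PreFrobenioidData.setting_of_isOfFSMFFType2024 Ψ hF₁ hF₂ hperf₁ hperf₂ hpf₁ hpf₂ hD₁ hD₂
      (thm42Setting_of_cor411Setting histr₁ histr₂ hng₁ hng₂ hs))
    hbfn₁ hbfn₂ Supp hSupp hrat R₁ R₂ hs

/-- **[FrdI] Cor. 4.11 (iv) AS TYPED over bases of FSMFF-type (revised), perfect-type case — NO Thm. 3.4 /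
Thm. 4.2 / Thm. 4.9 hypothesis left.** [cite: MochizukiFrdI2008, Cor. 4.11 (iv) p.92]
[cite: MochizukiFrdIComments2024, (28) p.3] -/
theorem cor411iv_of_perfectType_of_isOfFSMFFType2024 (hF₁ : IsFrobenioid F₁) (hF₂ : IsFrobenioid F₂)
    (hperf₁ : IsOfPerfectType F₁) (hperf₂ : IsOfPerfectType F₂)
    (hpf₁ : Objectwise (fun M _ => IsPerfFactorial M) Φ₁) (hpf₂ : Objectwise (fun M _ => IsPerfFactorial M) Φ₂)
    (hD₁ : IsOfFSMFFType2024 D₁) (hD₂ : IsOfFSMFFType2024 D₂)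
    (histr₁ : IsOfIsotropicType F₁) (histr₂ : IsOfIsotropicType F₂) (Ψ : C₁ ≌ C₂)
    (hng₁ : ¬ (PreFrobenioidData.ofFunctor Φ₁ F₁).IsOfGroupLikeType)
    (hng₂ : ¬ (PreFrobenioidData.ofFunctor Φ₂ F₂).IsOfGroupLikeType)
    (hbfn₁ : ∀ A : C₁, IsBiratFrobeniusNormalized F₁ hF₁ (hasBiratSquares_of_isFrobenioid hF₁) A)
    (hbfn₂ : ∀ A : C₂, IsBiratFrobeniusNormalized F₂ hF₂ (hasBiratSquares_of_isFrobenioid hF₂) A)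
    (Supp : ∀ {X : D₁}, (PreFrobenioidData.ofFunctor Φ₁ F₁).Mon X →
      Primes ((PreFrobenioidData.ofFunctor Φ₁ F₁).Mon X) → Prop)
    (hSupp : ∀ (X : D₁) (a : Φ₁.obj (op X)) (𝔭 : Primes (Φ₁.obj (op X))),
      Supp a 𝔭 ↔ ∃ (a₀ : Φ₁.obj (op X)) (h₀ : IsPrimary a₀),
        Quotient.mk (primarySetoid _) ⟨a₀, h₀⟩ = 𝔭 ∧ Precsim a₀ a)
    (hrat : ∀ ⦃A : C₁⦄, IsUniversallyDivFrobeniusTrivial F₁ A →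
      PreFrobenioidData.IsRational (biratData hF₁ (hasBiratSquares_of_isFrobenioid hF₁)) Supp A)
    (R₁ : (PreFrobenioidData.ofFunctor Φ₁ F₁).RSParams) (R₂ : (PreFrobenioidData.ofFunctor Φ₂ F₂).RSParams) :
    (PreFrobenioidData.ofFunctor Φ₁ F₁).Cor411iv (PreFrobenioidData.ofFunctor Φ₂ F₂) Ψ R₁ R₂ :=
  fun hs => cor411iv_inst_of_setting
    (PreFrobenioidData.setting_of_isOfFSMFFType2024 Ψ hF₁ hF₂ hperf₁ hperf₂ hpf₁ hpf₂ hD₁ hD₂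
      (thm42Setting_of_cor411Setting histr₁ histr₂ hng₁ hng₂ hs))
    hbfn₁ hbfn₂ Supp hSupp hrat R₁ R₂ hs

end FrdI.T42

end Literature.AlgebraicGeometry.Frobenioids
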